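import Summits.BirchSwinnertonDyer.BirchSwinnertonDyer.Theses.UniversalToricDescent
import Summits.BirchSwinnertonDyer.BirchSwinnertonDyer.Theorems.UniversalToricDescentHsiehDescentEngineAtThree
import Summits.BirchSwinnertonDyer.BirchSwinnertonDyer.Theorems.ClassRecordThreeOpenValueReciprocityOfArchimedean
import Summits.BirchSwinnertonDyer.Rank1Residual.X11b.LambdaSupplyPrime
import Summits.BirchSwinnertonDyer.Rank1Residual.X11b.EmbeddingDatumPrime
import Literature.NumberTheory.EllipticCurves.Hsieh2014.AnticyclotomicPAdicLFunctionAnyLevel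
import Literature.NumberTheory.EllipticCurves.BDPCentralValueReciprocity
import Literature.FieldTheory.AlgClosed.PadicAlgClEquivComplex
import HarnessLib

set_option linter.dupNamespace false -- `Summit.BirchSwinnertonDyer.BirchSwinnertonDyer.Theorems.…` (summit = sub, D-0017)
set_option autoImplicit false

/-! # Route `UniversalToricDescent` — item stmt-BirchSwinnertonDyer-24475 `WildSplitFrameAtThreeOddOfPrint` CLOSED
# (crux #4d at ODD `d_K` from print: Hsieh 2014 Thm A at any level + BDP13 Thm 5.5 + the curve-free descent engine)

Cell `bsd-wall`, prover seat `bsd-wall-utd-s1` (g0); ticket E-port (`pub/bsd-wall/bsd-wall-pss3x/utdB/TICKETS-B.md`).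
The route item reads: `Hsieh2014.thmA_exists_isHsiehLFunction_unrPeriod_anyLevel →
bertoliniDarmonPrasanna2013_centralValue_reciprocity → [item 20928 WildSplitFrameAtThree with the binder Odd (discr K)
inserted after the Heegner hypothesis]`. PROOF (= planner sketch `pub/bsd-wall/bsd-wall-utd-idea/Sketch-utd-idea-g13.lean`
c7defdb691e92c70, T1 + T2♯ + T4′, re-homed against the route declaration BY NAME):
* T1 `valueReciprocityAt_of_bdp2013`: BDP13 Thm 5.5 (every `σ ∈ Aut(ℂ/F)`, `F ⊇ K` unramified above the odd split primes,
  permutes the normalised central values) ⟹ SHARP value reciprocity of `bdpInterpolationValue 3 Dt.f 𝔭 · · Ω` at the datum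
  (x11b3's glue `bdpInterpolationValue_exact_of_normalizedValue_exact` + `exists_level_forall_fixing_rootsOfUnity_apply_symm_eq`);
* the closer: an embedding datum `ι′` inducing `𝔭` (`X11b.exists_datum_forall_mem_iff`), Hsieh's auxiliary `λ`
  (`X11b.lambdaSupplyAt`), Hsieh 2014 Thm A at any level ⟹ a witness `(A, Ω_K, C, Ω_p ∈ R₀ˣ, Q)`, and the curve-free engine
  `HsiehDescentEngineAtThree.hsiehDescentEngineAtThree` (soed-p1-w2 g7's E-port of cn100's descent,
  `Theorems/UniversalToricDescentHsiehDescentEngineAtThree.lean`) ⟹ the `R₀`-frame; `Ω_p′ ≠ 0` because it is a unit of `R₀`.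
HONEST FRAMING: the item is an implication from two PRINTED inputs (Literature named facts, hypotheses of the item itself);
this file proves that implication unconditionally. It does not prove crux #4 at even `d_K`, the route `UniversalToricDescent`,
or BSD. References: [Hsieh2014] Thm. A/5.6; [BertoliniDarmonPrasanna2013] Thm. 5.5, (5.1.16), Lemma 5.3;
[CastellaHsieh2018] §2.5; [Castella2018] Thm. 3.1. -/

noncomputable section

open scoped NumberField
open NumberField IsDedekindDomain Field WeierstrassCurve PowerSeries
open Literature.NumberTheory.GaloisRepresentations Literature.NumberTheory.EllipticCurves
open Literature.NumberTheory.EllipticCurves.ModularForms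
open Literature.NumberTheory.EllipticCurves.Rank1Residual
open Summit.BirchSwinnertonDyer.Rank1Residual Summit.BirchSwinnertonDyer.Rank1Residual.X11b
open Summit.BirchSwinnertonDyer.Rank1Residual.X11b.Three
open Summit.BirchSwinnertonDyer.Rank1Residual.Additive (ClassO6)
open Summit.BirchSwinnertonDyer.BirchSwinnertonDyer.Theorems (SchneiderFree.BranchInducesPrime)
open Summit.BirchSwinnertonDyer.BirchSwinnertonDyer.Theorems.UnramifiedOpen
  (exists_level_forall_fixing_rootsOfUnity_apply_symm_eq)

namespace Summit.BirchSwinnertonDyer.BirchSwinnertonDyer.Theorems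

namespace UniversalToricDescentWildSplitFrameAtThreeOddOfPrint

/-- A curve of class O6 at `3` is additive at `3`, hence `3 ∣ N_W`. -/
theorem three_dvd_of_classO6 {W : WeierstrassCurve ℚ} [W.IsElliptic] [W.IsGloballyMinimal] {N : ℕ}
    (hO6 : ClassO6 W 3) (hN : W.conductorNorm ℤ = N) : 3 ∣ N := by
  haveI : Fact (Nat.Prime 3) := ⟨Nat.prime_three⟩
  exact hN ▸ (W.dvd_conductorNorm_iff_not_hasGoodReductionAtPrime 3).mpr (not_good_of_addv W 3 hO6.2.1)

/-- **T1 — sharp value reciprocity at a wild datum from BDP13 Thm 5.5.** For `W` of class O6 at `3` with conductor `N`,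
`K` imaginary quadratic Heegner for `N` with ODD `d_K`, `𝔭` a prime of `K`, `κ` a `ℤ₃`-extension and `ι′ : ℚ̄₃ ≃ ℂ`:
`bertoliniDarmonPrasanna2013_centralValue_reciprocity` gives `Ω ≠ 0` and `m ≥ 1`, `3 ∤ m`, with EXACT reciprocity
`σ(bdpInterpolationValue 3 Dt.f 𝔭 χ n Ω) = bdpInterpolationValue 3 Dt.f 𝔭 (^σχ) n Ω` for every `τ ∈ G_{ℚ₃}` fixing `μ_m`,
every `σ ∈ Aut(ℂ/ℚ)` over `τ` along `ι′`, every everywhere-unramified `χ` of type `(n, −n)`, `n > 0`. The fact is stated for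
every conductor (it covers `27 ∣ N`); `3` splits in `K` by the Heegner hypothesis at `3 ∣ N`, so the reciprocity field
`F` is unramified above `3` and some `μ_m` (`3 ∤ m`) controls `Aut(ℂ/F)` along `ι′`. Sketch T1 verbatim.
[cite: BertoliniDarmonPrasanna2013, Thm. 5.5 with (5.1.16), Prop. 1.12 (1), Lemma 5.3] -/
theorem valueReciprocityAt_of_bdp2013 (h : bertoliniDarmonPrasanna2013_centralValue_reciprocity)
    (W : WeierstrassCurve ℚ) [W.IsElliptic] [W.IsGloballyMinimal] (N : ℕ) [NeZero N] (K : Type) [Field K]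
    [NumberField K] (Dt : ModularParametrizationData W N) (𝔭 : HeightOneSpectrum (𝓞 K)) (κ : ZpExtension K 3)
    (hO6 : ClassO6 W 3) (hN : W.conductorNorm ℤ = N) (hKiq : IsImaginaryQuadratic K)
    (hHeeg : SatisfiesHeegnerHypothesis N K) (hodd : Odd (NumberField.discr K)) (ι' : PadicAlgCl 3 ≃+* ℂ) :
    ∃ Ω : ℂ, Ω ≠ 0 ∧ ∃ m : ℕ, 0 < m ∧ ¬ 3 ∣ m ∧
      ∀ (τ : PadicAlgCl 3 ≃ₐ[ℚ_[3]] PadicAlgCl 3) (σ : ℂ ≃ₐ[ℚ] ℂ),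
        (∀ ζ : PadicAlgCl 3, ζ ^ m = 1 → τ ζ = ζ) → (∀ z : PadicAlgCl 3, σ (ι' z) = ι' (τ z)) →
        ∀ (χ : HeckeCharacter K) (n : ℕ), 0 < n → (∀ v : HeightOneSpectrum (𝓞 K), χ.IsUnramifiedAt v) →
          ∀ hχ : χ.HasInfinityType (fun _ ↦ (n : ℤ)) (fun _ ↦ -(n : ℤ)),
            ∀ r : FramedGaloisRep K (PadicAlgCl 3) 1, IsPAdicAvatarOf ι' χ r → FactorsThroughZp κ r →
              σ (bdpInterpolationValue 3 Dt.f 𝔭 χ n Ω) = bdpInterpolationValue 3 Dt.f 𝔭 (hχ.autConj σ) n Ω := by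
  haveI : Fact (Nat.Prime 3) := ⟨Nat.prime_three⟩
  have h3N : 3 ∣ N := three_dvd_of_classO6 hO6 hN
  have hsplit : ((Ideal.span {((3 : ℕ) : ℤ)}).primesOver (𝓞 K)).ncard = 2 := hHeeg 3 Nat.prime_three h3N
  obtain ⟨Ω, F, hΩ, hFd, -, hunrF, hexact⟩ := h W K Dt.f Dt.isNewformOf hN hKiq hodd hHeeg
  have hunr3 : ∀ P : Ideal (𝓞 F), P.IsPrime → ((3 : ℕ) : 𝓞 F) ∈ P → P.ramificationIdx (𝓞 ℚ) = 1 :=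
    hunrF 3 Nat.prime_three (by decide) hsplit
  obtain ⟨m, hm, h3m, hfix⟩ := exists_level_forall_fixing_rootsOfUnity_apply_symm_eq 3 ι' F hFd hunr3
  refine ⟨Ω, hΩ, m, hm, h3m, fun τ σ hτ hστ χ n hn hunrχ hχ _ _ _ ↦ ?_⟩
  have hσF : ∀ x : ℂ, x ∈ F → σ x = x := fun x hx ↦ by
    have h := hστ (ι'.symm x)
    rwa [ι'.apply_symm_apply, hfix τ hτ x hx, ι'.apply_symm_apply] at h
  exact bdpInterpolationValue_exact_of_normalizedValue_exact 3
    (exists_int_cuspCoeff_eq_of_isNewformOf Dt.isNewformOf 3) 𝔭 hχ n Ω σ (hexact σ hσF χ n hn hunrχ hχ)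

end UniversalToricDescentWildSplitFrameAtThreeOddOfPrint

open UniversalToricDescentWildSplitFrameAtThreeOddOfPrint in
/-- **Item stmt-BirchSwinnertonDyer-24475 `WildSplitFrameAtThreeOddOfPrint` (route `UniversalToricDescent`, support,
crux #4d at ODD `d_K` from print), BY NAME.** Hsieh 2014 Thm A at any level → BDP13 Thm 5.5 → for `W` wild at `3`
(`ClassO6 W 3`), `N = N_W`, `K` imaginary quadratic Heegner for `N` with `d_K` odd, `(κ, γ)` anticyclotomic, `𝔭 ∋ 3`: some
embedding datum `ι′` induces `𝔭` and an `R₀`-valued frame `(Ω_K ≠ 0, Ω_p ≠ 0, L ∈ R₀⟦T⟧)` with Castella's interpolation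
property `IsBDPLFunction ι′ 𝔭 κ γ Dt.f Ω_K Ω_p L` exists. PROOF: datum `ι′` (`X11b.exists_datum_forall_mem_iff`), Hsieh's
`λ` (`X11b.lambdaSupplyAt`), the Hsieh witness with `Ω_p ∈ R₀ˣ` (first hypothesis), sharp value reciprocity (T1, second
hypothesis) and the curve-free descent engine `HsiehDescentEngineAtThree.hsiehDescentEngineAtThree`.
Unconditional as an implication; BSD is not proved by this.
[cite: Hsieh2014, Thm. A and Thm. 5.6] [cite: BertoliniDarmonPrasanna2013, Thm. 5.5] [cite: CastellaHsieh2018, §2.5] -/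
theorem wildSplitFrameAtThreeOddOfPrint_proof : Theses.UniversalToricDescent.WildSplitFrameAtThreeOddOfPrint := by
  intro hT1 hBDP W _ _ N _ K _ _ Dt hO6 hN hK hHN hodd κ hκ γ hγ 𝔭 h𝔭
  haveI : Fact (Nat.Prime 3) := ⟨Nat.prime_three⟩
  have h3N : 3 ∣ N := three_dvd_of_classO6 hO6 hN
  have hsplit : ((Ideal.span {((3 : ℕ) : ℤ)}).primesOver (𝓞 K)).ncard = 2 := hHN 3 Nat.prime_three h3N
  obtain ⟨ι₀⟩ := PadicAlgCl.nonempty_ringEquiv_complex 3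
  obtain ⟨ι', -, hι'⟩ := X11b.exists_datum_forall_mem_iff 3 ι₀ hK h𝔭
  obtain ⟨lam, rlam, hunit, hinfl, hAQ, hunrl, havl, hfacl⟩ :=
    X11b.lambdaSupplyAt (p := 3) (by norm_num) ι' K κ hK hκ
  obtain ⟨A, ΩK, C, Ωp, Q, hA, hΩK, hC, hQ⟩ :=
    hT1 ι' K 𝔭 κ γ Dt.f lam rlam (by norm_num) Dt.isNewformOf.1 hK hsplit h𝔭 hι' hHN hunit hinfl hAQ hunrl
      havl hfacl hκ hγ.out
  obtain ⟨ΩK', Ωp', L, hΩK', hL⟩ :=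
    HsiehDescentEngineAtThree.hsiehDescentEngineAtThree K N Dt.f 𝔭 κ γ ι' h3N hK hsplit h𝔭 hκ
      (valueReciprocityAt_of_bdp2013 hBDP W N K Dt 𝔭 κ hO6 hN hK hHN hodd ι') A ΩK C Ωp Q hA hΩK hC hQ
  refine ⟨ι', hι', ΩK', ((Ωp' : unrIntegers 3) : ℂ_[3]), L, hΩK', ?_, hL⟩
  have h1 : ‖((Ωp' : unrIntegers 3) : ℂ_[3])‖ = 1 := (unrIntegers.isUnit_iff_norm_eq_one _).1 Ωp'.isUnit
  intro h0
  rw [h0, norm_zero] at h1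
  exact zero_ne_one h1

end Summit.BirchSwinnertonDyer.BirchSwinnertonDyer.Theorems

end
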